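import Literature.Analysis.ODE.SlowColumnSlavingIntWindow
import Literature.Analysis.ODE.ThreeTermLadderExistence
import HarnessLib

/-!
# The slot map of a three-term ladder in block form `(m, φ, ψ, χ)` — general data

Topic `Literature/Analysis/ODE` (namespace `Literature.Analysis.ODE.IntWindowLadder`). Everything here is PROVED
(no definition, no named fact): this file PACKAGES the integer-window slaving lemmas of
`Literature.Analysis.ODE.SlowColumnSlavingIntWindow` (invariant cone, slot-column law, slaved fast profile,
other columns, linearity, phase) into the two-time-scale BLOCK FORM of the propagator of one slot `[t₀, t₁]`
acting on a GENERAL datum `(a, f)` = (slow entry `a = v_0(t₀)`, fast part `f = (v_J(t₀))_{J ≠ 0}`):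

  `v_0(t) = m(t)·a + (slow feed of f)`,      `|slow feed| ≤ φ(t)·‖f‖`,
  `‖fast(t)‖ ≤ ψ(t)·m(t)·|a| + χ(t)·‖f‖`,

with ONE datum-independent positive multiplier `m(t) = ‖u_0(t)‖`, `u` the UNIT COLUMN (datum `e_0`), obeying the
two-sided second-order law of `column_law_intWindow`, and the explicit constants
`φ = (g_Tγ/Δ) e^{x'(t−t₀)}`, `ψ = Λ(|s_0||j₁(t)| + |s_{−1}||j₋₁(t)|) + Q`, `χ = e^{−ΛΔ(t−t₀)} + (g_Tγ/Δ)² e^{x'(t−t₀)}`,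
`x' = Λ(g_Tγ)²/Δ`, `Q = g_T R(2 + γR)/Δ` — Kokotović's block-triangular (two-time-scale) decomposition of a
linear slow/fast system, [cite: KokotovicBensoussanBlankenship1987, Kokotović §2 (2.16)–(2.20), Thm 2.3], with the
slow exponent to second order (Hartman–Wintner / Eastham [cite: Eastham1989, §1.5 Thm 1.5.1]) and every constant
explicit and uniform in the window `W`.

* `unitColumn_pos` — the unit column's slow entry is real positive: `u_0(t) = ‖u_0(t)‖ > 0`;
* `slotMap_slow_intWindow` — `‖v_0(t) − ‖u_0(t)‖·v_0(t₀)‖ ≤ φ(t) √Z₀` for EVERY trajectory `v` (`Z₀ = Σ_{J≠0}‖v_J(t₀)‖²`);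
* `slotMap_fast_intWindow` — `√(Σ_{J≠0}‖v_J(t)‖²) ≤ ψ(t) ‖u_0(t)‖ ‖v_0(t₀)‖ + χ(t) √Z₀`;
* `slotMap_law_intWindow` — `|log ‖u_0(t)‖² + 2Λ d_0 (t−t₀) + 2Λ(Φ t − Φ t₀)| ≤ 2Λ g_T γ Q (t−t₀)`;
* `exists_slotMap_intWindow` — for continuous `g` the unit column exists (`exists_solution_intWindow`), so the
  four statements hold with SOME `m : ℝ → ℝ`, `m(t₀) = 1`, `m > 0`, simultaneously for all trajectories.

Consumer (cell `ad-ideate`, K2R `stub_lowSectorDecay`, §4 slaving for all low sectors): per slot (or same-direction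
pair of slots, taking the pair envelope as `g` on the union window) this is the entire slow/fast bookkeeping; the
multiplier's main term `2Λ(Φ t₁ − Φ t₀)` is evaluated in closed form by `SlowColumnSlavingTrapezoid`, the per-slot
errors are `O(g_T)`-relative (`Q`) and `O(g_T²)`-absolute (`φψ`, `φ²`), with constants free of the window `W`.
-/

noncomputable section

namespace Literature.Analysis.ODE

namespace IntWindowLadder

open Set Finset Complex Filter
open scoped BigOperators ComplexConjugate Topology

/-! ## §0 Helpers -/

/-- Scalar multiples of solutions are solutions. [folklore] -/
private theorem smul_solution' (W : Finset ℤ) (d s : ℤ → ℝ) (Λ t₀ t₁ : ℝ) (g : ℝ → ℝ) (u : ℝ → ℤ → ℂ) (β : ℂ)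
    (hu : ∀ t ∈ Icc t₀ t₁, ∀ J ∈ W, HasDerivWithinAt (fun τ => u τ J)
        (-(Λ : ℂ) * ((d J : ℂ) * u t J) - (g t : ℂ) * (Λ : ℂ) * ((s (J - 1) : ℂ) * u t (J - 1) - (s J : ℂ) * u t (J + 1)))
        (Icc t₀ t₁) t) :
    ∀ t ∈ Icc t₀ t₁, ∀ J ∈ W, HasDerivWithinAt (fun τ => β * u τ J)
        (-(Λ : ℂ) * ((d J : ℂ) * (β * u t J)) -
          (g t : ℂ) * (Λ : ℂ) * ((s (J - 1) : ℂ) * (β * u t (J - 1)) - (s J : ℂ) * (β * u t (J + 1))))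
        (Icc t₀ t₁) t := by
  intro t ht J hJ
  refine ((hu t ht J hJ).const_mul β).congr_deriv ?_
  ring

/-- Minkowski in `ℓ²` of a finite set: `√Σ‖a + b‖² ≤ √Σ‖a‖² + √Σ‖b‖²`. [folklore] -/
private theorem sqrt_sum_norm_add_sq_le {ι : Type*} (T : Finset ι) (a b : ι → ℂ) :
    Real.sqrt (∑ J ∈ T, ‖a J + b J‖ ^ 2) ≤
      Real.sqrt (∑ J ∈ T, ‖a J‖ ^ 2) + Real.sqrt (∑ J ∈ T, ‖b J‖ ^ 2) := by
  have hA : 0 ≤ ∑ J ∈ T, ‖a J‖ ^ 2 := Finset.sum_nonneg fun J _ => sq_nonneg _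
  have hB : 0 ≤ ∑ J ∈ T, ‖b J‖ ^ 2 := Finset.sum_nonneg fun J _ => sq_nonneg _
  have hcs : ∑ J ∈ T, ‖a J‖ * ‖b J‖ ≤ Real.sqrt (∑ J ∈ T, ‖a J‖ ^ 2) * Real.sqrt (∑ J ∈ T, ‖b J‖ ^ 2) :=
    Real.sum_mul_le_sqrt_mul_sqrt T (fun J => ‖a J‖) (fun J => ‖b J‖)
  have hle : ∑ J ∈ T, ‖a J + b J‖ ^ 2 ≤
      (Real.sqrt (∑ J ∈ T, ‖a J‖ ^ 2) + Real.sqrt (∑ J ∈ T, ‖b J‖ ^ 2)) ^ 2 := by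
    have e : ∀ J, (‖a J‖ + ‖b J‖) ^ 2 = ‖a J‖ ^ 2 + ‖b J‖ ^ 2 + 2 * (‖a J‖ * ‖b J‖) := fun J => by ring
    calc ∑ J ∈ T, ‖a J + b J‖ ^ 2 ≤ ∑ J ∈ T, (‖a J‖ + ‖b J‖) ^ 2 :=
          Finset.sum_le_sum fun J _ => pow_le_pow_left₀ (norm_nonneg _) (norm_add_le _ _) 2
      _ = ∑ J ∈ T, ‖a J‖ ^ 2 + ∑ J ∈ T, ‖b J‖ ^ 2 + 2 * ∑ J ∈ T, ‖a J‖ * ‖b J‖ := by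
          simp_rw [e, Finset.sum_add_distrib, Finset.mul_sum]
      _ ≤ ∑ J ∈ T, ‖a J‖ ^ 2 + ∑ J ∈ T, ‖b J‖ ^ 2 +
            2 * (Real.sqrt (∑ J ∈ T, ‖a J‖ ^ 2) * Real.sqrt (∑ J ∈ T, ‖b J‖ ^ 2)) := by linarith
      _ = (Real.sqrt (∑ J ∈ T, ‖a J‖ ^ 2) + Real.sqrt (∑ J ∈ T, ‖b J‖ ^ 2)) ^ 2 := by
          rw [add_sq, Real.sq_sqrt hA, Real.sq_sqrt hB]; ring
  calc Real.sqrt (∑ J ∈ T, ‖a J + b J‖ ^ 2)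
      ≤ Real.sqrt ((Real.sqrt (∑ J ∈ T, ‖a J‖ ^ 2) + Real.sqrt (∑ J ∈ T, ‖b J‖ ^ 2)) ^ 2) :=
        Real.sqrt_le_sqrt hle
    _ = Real.sqrt (∑ J ∈ T, ‖a J‖ ^ 2) + Real.sqrt (∑ J ∈ T, ‖b J‖ ^ 2) :=
        Real.sqrt_sq (add_nonneg (Real.sqrt_nonneg _) (Real.sqrt_nonneg _))

/-- `√Σ‖c a_J‖² = ‖c‖ √Σ‖a_J‖²`. [folklore] -/
private theorem sqrt_sum_norm_mul_sq {ι : Type*} (T : Finset ι) (c : ℂ) (a : ι → ℂ) :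
    Real.sqrt (∑ J ∈ T, ‖c * a J‖ ^ 2) = ‖c‖ * Real.sqrt (∑ J ∈ T, ‖a J‖ ^ 2) := by
  have e : ∑ J ∈ T, ‖c * a J‖ ^ 2 = ‖c‖ ^ 2 * ∑ J ∈ T, ‖a J‖ ^ 2 := by
    rw [Finset.mul_sum]
    exact Finset.sum_congr rfl fun J _ => by rw [norm_mul, mul_pow]
  rw [e, Real.sqrt_mul (sq_nonneg _), Real.sqrt_sq (norm_nonneg _)]

/-- `√(x² + y²) ≤ |x| + |y|`. [folklore] -/
private theorem sqrt_sq_add_sq_le_abs_add_abs (x y : ℝ) : Real.sqrt (x ^ 2 + y ^ 2) ≤ |x| + |y| := by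
  have h : x ^ 2 + y ^ 2 ≤ (|x| + |y|) ^ 2 := by
    rw [add_sq, sq_abs, sq_abs]; nlinarith [abs_nonneg x, abs_nonneg y]
  calc Real.sqrt (x ^ 2 + y ^ 2) ≤ Real.sqrt ((|x| + |y|) ^ 2) := Real.sqrt_le_sqrt h
    _ = |x| + |y| := Real.sqrt_sq (add_nonneg (abs_nonneg _) (abs_nonneg _))

/-! ## §1 The unit column: a real positive, datum-independent slot multiplier -/

/-- **The unit column.** For the trajectory `u` from the datum `e_0` (`u_0(t₀) = 1`, `u_J(t₀) = 0` for `J ≠ 0`) of a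
three-term ladder with real links, gap `Δ` off the slow index and an admissible cone radius `R`
(`g_Tγ(1 + R²) < ΔR`), the slow entry is REAL POSITIVE throughout: `u_0(t) = ‖u_0(t)‖`, `‖u_0(t)‖ > 0` — the slot
multiplier `m(t) := ‖u_0(t)‖` carries no phase and never vanishes.
[cite: KokotovicBensoussanBlankenship1987, Kokotović §2 (2.19)–(2.20), Thm 2.3] -/
theorem unitColumn_pos (W : Finset ℤ) (h0 : (0 : ℤ) ∈ W) (h1 : (1 : ℤ) ∈ W) (hm1 : (-1 : ℤ) ∈ W)
    (d s : ℤ → ℝ) (Λ gT Δ γ R t₀ t₁ : ℝ) (g : ℝ → ℝ) (u : ℝ → ℤ → ℂ)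
    (hγ : γ ^ 2 = s 0 ^ 2 + s (-1) ^ 2) (hγ0 : 0 ≤ γ)
    (hΔ : ∀ J ∈ W, J ≠ 0 → d 0 + Δ ≤ d J) (hΛ : 0 < Λ)
    (hg : ∀ t ∈ Ioo t₀ t₁, |g t| ≤ gT) (hR : 0 < R) (htrap : gT * γ * (1 + R ^ 2) < Δ * R)
    (husupp : ∀ t ∈ Icc t₀ t₁, ∀ J, J ∉ W → u t J = 0)
    (hu : ∀ t ∈ Icc t₀ t₁, ∀ J ∈ W, HasDerivWithinAt (fun τ => u τ J)
        (-(Λ : ℂ) * ((d J : ℂ) * u t J) - (g t : ℂ) * (Λ : ℂ) * ((s (J - 1) : ℂ) * u t (J - 1) - (s J : ℂ) * u t (J + 1)))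
        (Icc t₀ t₁) t)
    (hu0 : u t₀ 0 = 1) (hucol : ∀ J, J ≠ 0 → u t₀ J = 0) :
    ∀ t ∈ Icc t₀ t₁, u t 0 = ((‖u t 0‖ : ℝ) : ℂ) ∧ 0 < ‖u t 0‖ := by
  have hre : 0 < (u t₀ 0).re := by rw [hu0]; norm_num
  have him : (u t₀ 0).im = 0 := by rw [hu0]; norm_num
  have hnorm := column_slow_eq_norm_intWindow W h0 h1 hm1 d s Λ gT Δ γ R t₀ t₁ g u hγ hγ0 hΔ hΛ hg hR htrap
    husupp hu hucol hre him
  have hinit : ∑ J ∈ W.erase 0, ‖u t₀ J‖ ^ 2 < R ^ 2 * ‖u t₀ 0‖ ^ 2 := by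
    rw [Finset.sum_eq_zero (fun J hJ => by
      rw [hucol J (Finset.ne_of_mem_erase hJ), norm_zero, zero_pow two_ne_zero]), hu0, norm_one, one_pow,
      mul_one]
    positivity
  have hcone := cone_intWindow W h0 h1 hm1 d s Λ gT Δ γ R t₀ t₁ g u hγ hγ0 hΔ hΛ hg hR htrap husupp hu hinit
  exact fun t ht => ⟨hnorm t ht, (hcone t ht).2⟩

/-! ## §2 The slow row of the slot map: `v_0(t) = m(t) v_0(t₀) + O(φ) ‖f‖` -/

/-- **Slot map, slow entry — general datum.** Three-term ladder on `W ∋ 0, ±1` (real links, gap `Δ > 0` off `0`,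
`d 0 ≥ 0`, coupling `|g| ≤ g_T`, `γ² = s 0² + s(−1)²`, admissible cone radius `R`) and its unit column `u`
(`unitColumn_pos`). Then EVERY trajectory `v` on `[t₀, t₁]` satisfies
`‖v_0(t) − ‖u_0(t)‖·v_0(t₀)‖ ≤ (g_Tγ/Δ) e^{Λ(g_Tγ)²(t−t₀)/Δ} √(Σ_{J≠0}‖v_J(t₀)‖²)`:
the slow entry is the datum times the slot multiplier, up to the feed of the fast datum (`split_intWindow` against
the scaled column `v_0(t₀)·u`, `column_slow_eq_norm_intWindow`).
[cite: KokotovicBensoussanBlankenship1987, Kokotović §2 (2.16)–(2.20), Thm 2.3] -/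
theorem slotMap_slow_intWindow (W : Finset ℤ) (h0 : (0 : ℤ) ∈ W) (h1 : (1 : ℤ) ∈ W) (hm1 : (-1 : ℤ) ∈ W)
    (d s : ℤ → ℝ) (Λ gT Δ γ R t₀ t₁ : ℝ) (g : ℝ → ℝ) (u v : ℝ → ℤ → ℂ)
    (hγ : γ ^ 2 = s 0 ^ 2 + s (-1) ^ 2) (hγ0 : 0 ≤ γ)
    (hΔ : ∀ J ∈ W, J ≠ 0 → d 0 + Δ ≤ d J) (hΔ0 : 0 < Δ) (hd0 : 0 ≤ d 0) (hΛ : 0 < Λ)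
    (hg : ∀ t ∈ Ioo t₀ t₁, |g t| ≤ gT) (hgT : 0 ≤ gT) (hR : 0 < R) (htrap : gT * γ * (1 + R ^ 2) < Δ * R)
    (husupp : ∀ t ∈ Icc t₀ t₁, ∀ J, J ∉ W → u t J = 0)
    (hu : ∀ t ∈ Icc t₀ t₁, ∀ J ∈ W, HasDerivWithinAt (fun τ => u τ J)
        (-(Λ : ℂ) * ((d J : ℂ) * u t J) - (g t : ℂ) * (Λ : ℂ) * ((s (J - 1) : ℂ) * u t (J - 1) - (s J : ℂ) * u t (J + 1)))
        (Icc t₀ t₁) t)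
    (hu0 : u t₀ 0 = 1) (hucol : ∀ J, J ≠ 0 → u t₀ J = 0)
    (hvsupp : ∀ t ∈ Icc t₀ t₁, ∀ J, J ∉ W → v t J = 0)
    (hv : ∀ t ∈ Icc t₀ t₁, ∀ J ∈ W, HasDerivWithinAt (fun τ => v τ J)
        (-(Λ : ℂ) * ((d J : ℂ) * v t J) - (g t : ℂ) * (Λ : ℂ) * ((s (J - 1) : ℂ) * v t (J - 1) - (s J : ℂ) * v t (J + 1)))
        (Icc t₀ t₁) t) :
    ∀ t ∈ Icc t₀ t₁, ‖v t 0 - ((‖u t 0‖ : ℝ) : ℂ) * v t₀ 0‖ ≤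
      gT * γ / Δ * Real.exp (Λ * (gT * γ) ^ 2 / Δ * (t - t₀)) * Real.sqrt (∑ J ∈ W.erase 0, ‖v t₀ J‖ ^ 2) := by
  -- the scaled column `v¹ = v_0(t₀) · u`
  have h1supp : ∀ t ∈ Icc t₀ t₁, ∀ J, J ∉ W → (fun t J => v t₀ 0 * u t J) t J = 0 := fun t ht J hJ => by
    simp only [husupp t ht J hJ, mul_zero]
  have hv₁ := smul_solution' W d s Λ t₀ t₁ g u (v t₀ 0) hu
  have hcol0 : (fun t J => v t₀ 0 * u t J) t₀ 0 = v t₀ 0 := by simp only [hu0, mul_one]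
  have hcol : ∀ J, J ≠ 0 → (fun t J => v t₀ 0 * u t J) t₀ J = 0 := fun J hJ => by
    simp only [hucol J hJ, mul_zero]
  have hsplit := split_intWindow W h0 h1 hm1 d s Λ gT Δ γ t₀ t₁ g v (fun t J => v t₀ 0 * u t J) hγ hγ0 hΔ hΔ0
    hd0 hΛ hg hgT hvsupp hv h1supp hv₁ hcol0 hcol
  have hpos := unitColumn_pos W h0 h1 hm1 d s Λ gT Δ γ R t₀ t₁ g u hγ hγ0 hΔ hΛ hg hR htrap husupp hu hu0 hucol
  intro t ht
  have e : ((‖u t 0‖ : ℝ) : ℂ) * v t₀ 0 = v t₀ 0 * u t 0 := by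
    rw [← (hpos t ht).1, mul_comm]
  rw [e]
  exact (hsplit t ht).1

/-! ## §3 The fast row of the slot map: `‖fast(t)‖ ≤ ψ(t) m(t) |v_0(t₀)| + χ(t) ‖f‖` -/

/-- **Slot map, fast part — general datum.** Same setting, with `|s| ≤ 1` on `W` and the two real Duhamel
responses `j₁, j₋₁` of `g` at the rates `Λ(d_{±1} − d_0)` (`j' = g − Λ(d_{±1} − d_0) j`, `j(t₀) = 0`). Then EVERY
trajectory `v` on `[t₀, t₁]` satisfies
`√(Σ_{J≠0}‖v_J(t)‖²) ≤ (Λ(|s_0||j₁(t)| + |s_{−1}||j₋₁(t)|) + Q)·‖u_0(t)‖·‖v_0(t₀)‖`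
`  + (e^{−ΛΔ(t−t₀)} + (g_Tγ/Δ)² e^{Λ(g_Tγ)²(t−t₀)/Δ})·√(Σ_{J≠0}‖v_J(t₀)‖²)`, `Q = g_T R(2 + γR)/Δ`:
the fast content at time `t` is the slaved profile of the column (`column_remainder_intWindow`: first-order profile
`ρ_{±1} = ∓Λ s j_{±1}` within `Q`, relaxed by the ramps through `j_{±1}(t)`) plus the relaxed fast datum
(`split_intWindow`). [cite: KokotovicBensoussanBlankenship1987, Kokotović §2 (2.16)–(2.20), Thm 2.3]
[cite: Eastham1989, §1.5 Thm 1.5.1, (1.5.8)–(1.5.10)] -/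
theorem slotMap_fast_intWindow (W : Finset ℤ) (h0 : (0 : ℤ) ∈ W) (h1 : (1 : ℤ) ∈ W) (hm1 : (-1 : ℤ) ∈ W)
    (d s : ℤ → ℝ) (Λ gT Δ γ R t₀ t₁ : ℝ) (g j₁ jm : ℝ → ℝ) (u v : ℝ → ℤ → ℂ)
    (hs : ∀ J ∈ W, |s J| ≤ 1) (hγ : γ ^ 2 = s 0 ^ 2 + s (-1) ^ 2) (hγ0 : 0 ≤ γ)
    (hΔ : ∀ J ∈ W, J ≠ 0 → d 0 + Δ ≤ d J) (hΔ0 : 0 < Δ) (hd0 : 0 ≤ d 0) (hΛ : 0 < Λ)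
    (hg : ∀ t ∈ Ioo t₀ t₁, |g t| ≤ gT) (hgT : 0 ≤ gT) (hR : 0 < R) (htrap : gT * γ * (1 + R ^ 2) < Δ * R)
    (husupp : ∀ t ∈ Icc t₀ t₁, ∀ J, J ∉ W → u t J = 0)
    (hu : ∀ t ∈ Icc t₀ t₁, ∀ J ∈ W, HasDerivWithinAt (fun τ => u τ J)
        (-(Λ : ℂ) * ((d J : ℂ) * u t J) - (g t : ℂ) * (Λ : ℂ) * ((s (J - 1) : ℂ) * u t (J - 1) - (s J : ℂ) * u t (J + 1)))
        (Icc t₀ t₁) t)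
    (hu0 : u t₀ 0 = 1) (hucol : ∀ J, J ≠ 0 → u t₀ J = 0)
    (hj₁ : ∀ t ∈ Icc t₀ t₁, HasDerivWithinAt j₁ (g t - Λ * (d 1 - d 0) * j₁ t) (Icc t₀ t₁) t) (hj₁0 : j₁ t₀ = 0)
    (hjm : ∀ t ∈ Icc t₀ t₁, HasDerivWithinAt jm (g t - Λ * (d (-1) - d 0) * jm t) (Icc t₀ t₁) t)
    (hjm0 : jm t₀ = 0)
    (hvsupp : ∀ t ∈ Icc t₀ t₁, ∀ J, J ∉ W → v t J = 0)
    (hv : ∀ t ∈ Icc t₀ t₁, ∀ J ∈ W, HasDerivWithinAt (fun τ => v τ J)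
        (-(Λ : ℂ) * ((d J : ℂ) * v t J) - (g t : ℂ) * (Λ : ℂ) * ((s (J - 1) : ℂ) * v t (J - 1) - (s J : ℂ) * v t (J + 1)))
        (Icc t₀ t₁) t) :
    ∀ t ∈ Icc t₀ t₁, Real.sqrt (∑ J ∈ W.erase 0, ‖v t J‖ ^ 2) ≤
      (Λ * (|s 0| * |j₁ t| + |s (-1)| * |jm t|) + gT * R * (2 + γ * R) / Δ) * ‖u t 0‖ * ‖v t₀ 0‖ +
        (Real.exp (-(Λ * Δ) * (t - t₀)) + (gT * γ / Δ) ^ 2 * Real.exp (Λ * (gT * γ) ^ 2 / Δ * (t - t₀))) *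
          Real.sqrt (∑ J ∈ W.erase 0, ‖v t₀ J‖ ^ 2) := by
  -- the scaled column `v¹ = v_0(t₀) · u` and the split `v = v¹ + (v − v¹)`
  have h1supp : ∀ t ∈ Icc t₀ t₁, ∀ J, J ∉ W → (fun t J => v t₀ 0 * u t J) t J = 0 := fun t ht J hJ => by
    simp only [husupp t ht J hJ, mul_zero]
  have hv₁ := smul_solution' W d s Λ t₀ t₁ g u (v t₀ 0) hu
  have hcol0 : (fun t J => v t₀ 0 * u t J) t₀ 0 = v t₀ 0 := by simp only [hu0, mul_one]
  have hcol : ∀ J, J ≠ 0 → (fun t J => v t₀ 0 * u t J) t₀ J = 0 := fun J hJ => by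
    simp only [hucol J hJ, mul_zero]
  have hsplit := split_intWindow W h0 h1 hm1 d s Λ gT Δ γ t₀ t₁ g v (fun t J => v t₀ 0 * u t J) hγ hγ0 hΔ hΔ0
    hd0 hΛ hg hgT hvsupp hv h1supp hv₁ hcol0 hcol
  have hpos := unitColumn_pos W h0 h1 hm1 d s Λ gT Δ γ R t₀ t₁ g u hγ hγ0 hΔ hΛ hg hR htrap husupp hu hu0 hucol
  have hu00 : u t₀ 0 ≠ 0 := by rw [hu0]; exact one_ne_zero
  have hrem := column_remainder_intWindow W h0 h1 hm1 d s Λ gT Δ γ R t₀ t₁ g j₁ jm u hs hγ hγ0 hΔ hΔ0 hΛ hg hgT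
    hR htrap husupp hu hucol hu00 hj₁ hj₁0 hjm hjm0
  have hQ0 : 0 ≤ gT * R * (2 + γ * R) / Δ := by positivity
  intro t ht
  obtain ⟨-, hupos⟩ := hpos t ht
  have hut0 : u t 0 ≠ 0 := norm_pos_iff.1 hupos
  -- the first-order fast profile of the unit column at time `t`
  set ρ : ℤ → ℂ := fun J => if J = 1 then -(Λ : ℂ) * (s 0 : ℂ) * (j₁ t : ℂ)
    else if J = -1 then (Λ : ℂ) * (s (-1) : ℂ) * (jm t : ℂ) else 0 with hρ
  -- (i) the ratios stay within `Q` of the profile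
  have hratio : Real.sqrt (∑ J ∈ W.erase 0, ‖u t J / u t 0 - ρ J‖ ^ 2) ≤ gT * R * (2 + γ * R) / Δ := by
    have h : ∑ J ∈ W.erase 0, ‖u t J / u t 0 - ρ J‖ ^ 2 ≤ (gT * R * (2 + γ * R) / Δ) ^ 2 := by
      simpa only [hρ] using hrem t ht
    calc Real.sqrt (∑ J ∈ W.erase 0, ‖u t J / u t 0 - ρ J‖ ^ 2)
        ≤ Real.sqrt ((gT * R * (2 + γ * R) / Δ) ^ 2) := Real.sqrt_le_sqrt h
      _ = gT * R * (2 + γ * R) / Δ := Real.sqrt_sq hQ0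
  -- (ii) the profile's size
  have hρnorm : Real.sqrt (∑ J ∈ W.erase 0, ‖ρ J‖ ^ 2) ≤ Λ * (|s 0| * |j₁ t| + |s (-1)| * |jm t|) := by
    have hsum : ∑ J ∈ W.erase 0, ‖ρ J‖ ^ 2 = ‖ρ 1‖ ^ 2 + ‖ρ (-1)‖ ^ 2 := by
      refine Finset.sum_eq_add_of_mem (1 : ℤ) (-1 : ℤ) (Finset.mem_erase.2 ⟨one_ne_zero, h1⟩)
        (Finset.mem_erase.2 ⟨by norm_num, hm1⟩) (by norm_num) ?_
      intro J _ hJ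
      have e0 : ρ J = 0 := by simp only [hρ, if_neg hJ.1, if_neg hJ.2]
      rw [e0, norm_zero, zero_pow two_ne_zero]
    have e1 : ‖ρ 1‖ = Λ * (|s 0| * |j₁ t|) := by
      have : ρ 1 = -(Λ : ℂ) * (s 0 : ℂ) * (j₁ t : ℂ) := by simp only [hρ, if_true]
      rw [this, norm_mul, norm_mul, norm_neg, Complex.norm_real, Complex.norm_real, Complex.norm_real,
        Real.norm_eq_abs, Real.norm_eq_abs, Real.norm_eq_abs, abs_of_pos hΛ, mul_assoc]
    have e2 : ‖ρ (-1)‖ = Λ * (|s (-1)| * |jm t|) := by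
      have : ρ (-1) = (Λ : ℂ) * (s (-1) : ℂ) * (jm t : ℂ) := by
        simp only [hρ, show ¬ ((-1 : ℤ) = 1) by decide, if_false, if_true]
      rw [this, norm_mul, norm_mul, Complex.norm_real, Complex.norm_real, Complex.norm_real,
        Real.norm_eq_abs, Real.norm_eq_abs, Real.norm_eq_abs, abs_of_pos hΛ, mul_assoc]
    rw [hsum, e1, e2]
    calc Real.sqrt ((Λ * (|s 0| * |j₁ t|)) ^ 2 + (Λ * (|s (-1)| * |jm t|)) ^ 2)
        ≤ |Λ * (|s 0| * |j₁ t|)| + |Λ * (|s (-1)| * |jm t|)| := sqrt_sq_add_sq_le_abs_add_abs _ _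
      _ = Λ * (|s 0| * |j₁ t| + |s (-1)| * |jm t|) := by
          have ha : 0 ≤ Λ * (|s 0| * |j₁ t|) := by positivity
          have hb : 0 ≤ Λ * (|s (-1)| * |jm t|) := by positivity
          rw [abs_of_nonneg ha, abs_of_nonneg hb]; ring
  -- (iii) the unit column's fast content
  have hufast : Real.sqrt (∑ J ∈ W.erase 0, ‖u t J‖ ^ 2) ≤
      (Λ * (|s 0| * |j₁ t| + |s (-1)| * |jm t|) + gT * R * (2 + γ * R) / Δ) * ‖u t 0‖ := by
    have e : ∑ J ∈ W.erase 0, ‖u t J‖ ^ 2 =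
        ∑ J ∈ W.erase 0, ‖u t 0 * (ρ J + (u t J / u t 0 - ρ J))‖ ^ 2 := by
      refine Finset.sum_congr rfl fun J _ => ?_
      rw [add_sub_cancel, mul_div_assoc', mul_div_cancel_left₀ _ hut0]
    rw [e, sqrt_sum_norm_mul_sq]
    have hM := sqrt_sum_norm_add_sq_le (W.erase 0) ρ (fun J => u t J / u t 0 - ρ J)
    calc ‖u t 0‖ * Real.sqrt (∑ J ∈ W.erase 0, ‖ρ J + (u t J / u t 0 - ρ J)‖ ^ 2)
        ≤ ‖u t 0‖ * (Real.sqrt (∑ J ∈ W.erase 0, ‖ρ J‖ ^ 2) +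
            Real.sqrt (∑ J ∈ W.erase 0, ‖u t J / u t 0 - ρ J‖ ^ 2)) :=
          mul_le_mul_of_nonneg_left hM (norm_nonneg _)
      _ ≤ ‖u t 0‖ * (Λ * (|s 0| * |j₁ t| + |s (-1)| * |jm t|) + gT * R * (2 + γ * R) / Δ) :=
          mul_le_mul_of_nonneg_left (add_le_add hρnorm hratio) (norm_nonneg _)
      _ = (Λ * (|s 0| * |j₁ t| + |s (-1)| * |jm t|) + gT * R * (2 + γ * R) / Δ) * ‖u t 0‖ := mul_comm _ _
  -- (iv) the scaled column's fast content
  have hv₁fast : Real.sqrt (∑ J ∈ W.erase 0, ‖v t₀ 0 * u t J‖ ^ 2) ≤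
      (Λ * (|s 0| * |j₁ t| + |s (-1)| * |jm t|) + gT * R * (2 + γ * R) / Δ) * ‖u t 0‖ * ‖v t₀ 0‖ := by
    rw [sqrt_sum_norm_mul_sq]
    calc ‖v t₀ 0‖ * Real.sqrt (∑ J ∈ W.erase 0, ‖u t J‖ ^ 2)
        ≤ ‖v t₀ 0‖ * ((Λ * (|s 0| * |j₁ t| + |s (-1)| * |jm t|) + gT * R * (2 + γ * R) / Δ) * ‖u t 0‖) :=
          mul_le_mul_of_nonneg_left hufast (norm_nonneg _)
      _ = _ := by ring
  -- (v) assemble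
  have e2 : ∑ J ∈ W.erase 0, ‖v t J‖ ^ 2 =
      ∑ J ∈ W.erase 0, ‖v t₀ 0 * u t J + (v t J - v t₀ 0 * u t J)‖ ^ 2 := by
    refine Finset.sum_congr rfl fun J _ => ?_
    rw [add_sub_cancel]
  rw [e2]
  calc Real.sqrt (∑ J ∈ W.erase 0, ‖v t₀ 0 * u t J + (v t J - v t₀ 0 * u t J)‖ ^ 2)
      ≤ Real.sqrt (∑ J ∈ W.erase 0, ‖v t₀ 0 * u t J‖ ^ 2) +
          Real.sqrt (∑ J ∈ W.erase 0, ‖v t J - v t₀ 0 * u t J‖ ^ 2) := sqrt_sum_norm_add_sq_le _ _ _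
    _ ≤ _ := add_le_add hv₁fast (hsplit t ht).2

/-! ## §4 The law of the multiplier -/

/-- **Slot map, the multiplier's two-sided law.** For the unit column `u` and any primitive `Φ` of
`Λ g (s 0² j₁ + s(−1)² j₋₁)`: `|log ‖u_0(t)‖² + 2Λ d_0 (t − t₀) + 2Λ(Φ t − Φ t₀)| ≤ 2Λ g_T γ Q (t − t₀)` on
`[t₀, t₁]`, `Q = g_T R(2 + γR)/Δ` (`column_law_intWindow` with `log ‖u_0(t₀)‖² = 0`); the main term `2Λ(Φ t₁ − Φ t₀)`
is the quasi-static slot weight, in closed form for trapezoid slots by `SlowColumnSlavingTrapezoid`.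
[cite: Eastham1989, §1.5 Thm 1.5.1 (1.5.5), §1.6 Thm 1.6.1]
[cite: KokotovicBensoussanBlankenship1987, Kokotović §2 Thm 2.3 (2.40)] -/
theorem slotMap_law_intWindow (W : Finset ℤ) (h0 : (0 : ℤ) ∈ W) (h1 : (1 : ℤ) ∈ W) (hm1 : (-1 : ℤ) ∈ W)
    (d s : ℤ → ℝ) (Λ gT Δ γ R t₀ t₁ : ℝ) (g Φ j₁ jm : ℝ → ℝ) (u : ℝ → ℤ → ℂ)
    (hs : ∀ J ∈ W, |s J| ≤ 1) (hγ : γ ^ 2 = s 0 ^ 2 + s (-1) ^ 2) (hγ0 : 0 ≤ γ)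
    (hΔ : ∀ J ∈ W, J ≠ 0 → d 0 + Δ ≤ d J) (hΔ0 : 0 < Δ) (hΛ : 0 < Λ)
    (hg : ∀ t ∈ Ioo t₀ t₁, |g t| ≤ gT) (hgT : 0 ≤ gT) (hR : 0 < R) (htrap : gT * γ * (1 + R ^ 2) < Δ * R)
    (husupp : ∀ t ∈ Icc t₀ t₁, ∀ J, J ∉ W → u t J = 0)
    (hu : ∀ t ∈ Icc t₀ t₁, ∀ J ∈ W, HasDerivWithinAt (fun τ => u τ J)
        (-(Λ : ℂ) * ((d J : ℂ) * u t J) - (g t : ℂ) * (Λ : ℂ) * ((s (J - 1) : ℂ) * u t (J - 1) - (s J : ℂ) * u t (J + 1)))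
        (Icc t₀ t₁) t)
    (hu0 : u t₀ 0 = 1) (hucol : ∀ J, J ≠ 0 → u t₀ J = 0)
    (hj₁ : ∀ t ∈ Icc t₀ t₁, HasDerivWithinAt j₁ (g t - Λ * (d 1 - d 0) * j₁ t) (Icc t₀ t₁) t) (hj₁0 : j₁ t₀ = 0)
    (hjm : ∀ t ∈ Icc t₀ t₁, HasDerivWithinAt jm (g t - Λ * (d (-1) - d 0) * jm t) (Icc t₀ t₁) t)
    (hjm0 : jm t₀ = 0)
    (hΦ : ∀ t ∈ Icc t₀ t₁, HasDerivWithinAt Φ (Λ * g t * (s 0 ^ 2 * j₁ t + s (-1) ^ 2 * jm t)) (Icc t₀ t₁) t) :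
    ∀ t ∈ Icc t₀ t₁, |Real.log (‖u t 0‖ ^ 2) + 2 * Λ * d 0 * (t - t₀) + 2 * Λ * (Φ t - Φ t₀)| ≤
      2 * Λ * gT * γ * (gT * R * (2 + γ * R) / Δ) * (t - t₀) := by
  have hu00 : u t₀ 0 ≠ 0 := by rw [hu0]; exact one_ne_zero
  have h := column_law_intWindow W h0 h1 hm1 d s Λ gT Δ γ R t₀ t₁ g Φ j₁ jm u hs hγ hγ0 hΔ hΔ0 hΛ hg hgT hR
    htrap husupp hu hucol hu00 hj₁ hj₁0 hjm hjm0 hΦ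
  intro t ht
  have h' := h t ht
  rwa [hu0, norm_one, one_pow, Real.log_one, sub_zero] at h'

/-! ## §5 The packaged slot map (existence of the unit column for continuous coupling) -/

/-- **The slot map `(m, φ, ψ, χ)` of a three-term ladder — packaged.** Three-term ladder on a window `W ∋ 0, ±1`
with real links `|s| ≤ 1`, gap `d J ≥ d 0 + Δ` off `0` (`Δ > 0`, `d 0 ≥ 0`), rate `Λ > 0`, a CONTINUOUS real
coupling with `|g| ≤ g_T` on the slot, `γ² = s 0² + s(−1)²`, an admissible cone radius `R` (`g_Tγ(1+R²) < ΔR`),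
the Duhamel responses `j_{±1}` and a primitive `Φ` as in `slotMap_law_intWindow`. Then there is ONE function
`m : [t₀, t₁] → (0, ∞)`, `m(t₀) = 1`, with the two-sided law
`|log m(t)² + 2Λ d_0 (t−t₀) + 2Λ(Φ t − Φ t₀)| ≤ 2Λ g_T γ Q (t−t₀)`, such that EVERY trajectory `v` of the ladder on
`[t₀, t₁]` obeys the block estimates
`‖v_0(t) − m(t) v_0(t₀)‖ ≤ φ(t) √Z₀`, `√Z(t) ≤ ψ(t) m(t) ‖v_0(t₀)‖ + χ(t) √Z₀`
(`Z(t) = Σ_{J≠0}‖v_J(t)‖²`, `φ = (g_Tγ/Δ)e^{x'(t−t₀)}`, `ψ = Λ(|s_0||j₁| + |s_{−1}||j₋₁|) + Q`,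
`χ = e^{−ΛΔ(t−t₀)} + (g_Tγ/Δ)²e^{x'(t−t₀)}`, `x' = Λ(g_Tγ)²/Δ`, `Q = g_T R(2+γR)/Δ`) — the block-triangular
two-time-scale form of the slot propagator with explicit, window-uniform constants (`m` = slow entry of the unit
column, which exists by `exists_solution_intWindow`).
[cite: KokotovicBensoussanBlankenship1987, Kokotović §2 (2.16)–(2.20), Thm 2.3]
[cite: Eastham1989, §1.5 Thm 1.5.1] -/
theorem exists_slotMap_intWindow (W : Finset ℤ) (h0 : (0 : ℤ) ∈ W) (h1 : (1 : ℤ) ∈ W) (hm1 : (-1 : ℤ) ∈ W)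
    (d s : ℤ → ℝ) (Λ gT Δ γ R t₀ t₁ : ℝ) (g Φ j₁ jm : ℝ → ℝ)
    (hs : ∀ J ∈ W, |s J| ≤ 1) (hγ : γ ^ 2 = s 0 ^ 2 + s (-1) ^ 2) (hγ0 : 0 ≤ γ)
    (hΔ : ∀ J ∈ W, J ≠ 0 → d 0 + Δ ≤ d J) (hΔ0 : 0 < Δ) (hd0 : 0 ≤ d 0) (hΛ : 0 < Λ)
    (hgc : Continuous g) (hg : ∀ t ∈ Ioo t₀ t₁, |g t| ≤ gT) (hgT : 0 ≤ gT) (hR : 0 < R)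
    (htrap : gT * γ * (1 + R ^ 2) < Δ * R)
    (hj₁ : ∀ t ∈ Icc t₀ t₁, HasDerivWithinAt j₁ (g t - Λ * (d 1 - d 0) * j₁ t) (Icc t₀ t₁) t) (hj₁0 : j₁ t₀ = 0)
    (hjm : ∀ t ∈ Icc t₀ t₁, HasDerivWithinAt jm (g t - Λ * (d (-1) - d 0) * jm t) (Icc t₀ t₁) t)
    (hjm0 : jm t₀ = 0)
    (hΦ : ∀ t ∈ Icc t₀ t₁, HasDerivWithinAt Φ (Λ * g t * (s 0 ^ 2 * j₁ t + s (-1) ^ 2 * jm t)) (Icc t₀ t₁) t) :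
    ∃ m : ℝ → ℝ, m t₀ = 1 ∧ (∀ t ∈ Icc t₀ t₁, 0 < m t) ∧
      (∀ t ∈ Icc t₀ t₁, |Real.log (m t ^ 2) + 2 * Λ * d 0 * (t - t₀) + 2 * Λ * (Φ t - Φ t₀)| ≤
        2 * Λ * gT * γ * (gT * R * (2 + γ * R) / Δ) * (t - t₀)) ∧
      ∀ v : ℝ → ℤ → ℂ, (∀ t ∈ Icc t₀ t₁, ∀ J, J ∉ W → v t J = 0) →
        (∀ t ∈ Icc t₀ t₁, ∀ J ∈ W, HasDerivWithinAt (fun τ => v τ J)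
          (-(Λ : ℂ) * ((d J : ℂ) * v t J) -
            (g t : ℂ) * (Λ : ℂ) * ((s (J - 1) : ℂ) * v t (J - 1) - (s J : ℂ) * v t (J + 1))) (Icc t₀ t₁) t) →
        ∀ t ∈ Icc t₀ t₁,
          ‖v t 0 - ((m t : ℝ) : ℂ) * v t₀ 0‖ ≤
              gT * γ / Δ * Real.exp (Λ * (gT * γ) ^ 2 / Δ * (t - t₀)) *
                Real.sqrt (∑ J ∈ W.erase 0, ‖v t₀ J‖ ^ 2) ∧
            Real.sqrt (∑ J ∈ W.erase 0, ‖v t J‖ ^ 2) ≤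
              (Λ * (|s 0| * |j₁ t| + |s (-1)| * |jm t|) + gT * R * (2 + γ * R) / Δ) * m t * ‖v t₀ 0‖ +
                (Real.exp (-(Λ * Δ) * (t - t₀)) +
                    (gT * γ / Δ) ^ 2 * Real.exp (Λ * (gT * γ) ^ 2 / Δ * (t - t₀))) *
                  Real.sqrt (∑ J ∈ W.erase 0, ‖v t₀ J‖ ^ 2) := by
  -- the unit column exists
  obtain ⟨u, hu_init, husupp', hu⟩ := exists_solution_intWindow W d s Λ t₀ t₁ g hgc
    (fun J => if J = 0 then (1 : ℂ) else 0) (fun J hJ => by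
      have hJ0 : J ≠ 0 := fun h => hJ (h ▸ h0)
      simp only [if_neg hJ0])
  have husupp : ∀ t ∈ Icc t₀ t₁, ∀ J, J ∉ W → u t J = 0 := fun t _ J hJ => husupp' t J hJ
  have hu0 : u t₀ 0 = 1 := by rw [hu_init]; simp only [if_true]
  have hucol : ∀ J, J ≠ 0 → u t₀ J = 0 := fun J hJ => by rw [hu_init]; simp only [if_neg hJ]
  have hpos := unitColumn_pos W h0 h1 hm1 d s Λ gT Δ γ R t₀ t₁ g u hγ hγ0 hΔ hΛ hg hR htrap husupp hu hu0 hucol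
  refine ⟨fun t => ‖u t 0‖, by simp only [hu0, norm_one], fun t ht => (hpos t ht).2,
    slotMap_law_intWindow W h0 h1 hm1 d s Λ gT Δ γ R t₀ t₁ g Φ j₁ jm u hs hγ hγ0 hΔ hΔ0 hΛ hg hgT hR htrap
      husupp hu hu0 hucol hj₁ hj₁0 hjm hjm0 hΦ, fun v hvsupp hv t ht => ⟨?_, ?_⟩⟩
  · exact slotMap_slow_intWindow W h0 h1 hm1 d s Λ gT Δ γ R t₀ t₁ g u v hγ hγ0 hΔ hΔ0 hd0 hΛ hg hgT hR htrap
      husupp hu hu0 hucol hvsupp hv t ht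
  · exact slotMap_fast_intWindow W h0 h1 hm1 d s Λ gT Δ γ R t₀ t₁ g j₁ jm u v hs hγ hγ0 hΔ hΔ0 hd0 hΛ hg hgT
      hR htrap husupp hu hu0 hucol hj₁ hj₁0 hjm hjm0 hvsupp hv t ht

end IntWindowLadder

end Literature.Analysis.ODE

end
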